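import Mathlib
import Literature.LinearAlgebra.Matrix.HadamardProductRank
import Summits.PneNP.PneNP.Theorems.CnfIdealGenLengthRankDefectRepresentationsTwoFamilyCutDomination

/-!
# Crux `RankDefectRepresentations` (stmt-PneNP-18923), line `rank-dehn-ladder`: the MASK BOUND — a dual certificate for
# minimal completion rank (lead g13)

Every completion question on this line (the 1D cut lemma N1, the 2D max-cut decomposition, the registered stub
`stub_coreLinear` = CORE-LINEAR) asks for a matrix `L` of small rank agreeing with a partial matrix `D` on a set `Ω` of
VISIBLE cells.  Lower bounds for the minimal completion rank `mc(D)` were so far obtained by exact search (SAT over `F₂`,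
`N ≤ 36`) or by TRIANGULAR configurations, which g9 capped at `16c` for the two-family pattern.  This file records the
cheapest general certificate, which is neither:

  **MASK BOUND.**  If `σ` vanishes at every invisible cell, then for every completion `L` of `D`
  (`L = D` on the visible cells) `rank (D ⊙ σ) ≤ rank L · rank σ`, i.e. `mc(D) ≥ rank (D ⊙ σ) / rank σ`.

(`L ⊙ σ = D ⊙ σ` because `σ` kills the cells where `L` is free, and Hadamard rank is submultiplicative,
`Literature.LinearAlgebra.Matrix.HadamardProductRank.rank_hadamard_le`.)  It certifies the twisted 3-cycle
`{(?,1,1),(1,?,t),(1,1,?)}`, `t ∉ {0,1}` (all cuts of rank 1, `mc = 2`: the zero-diagonal mask `σ = [[0,a,b],[c,0,d],[e,f,0]]`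
with `ade + bcf = 0` has rank 2 and `D ⊙ σ` has rank 3), which no triangular configuration sees; for the two-family
pattern the natural masks are the rank-`≤ 4` products `σ[(i,j),(i′,j′)] = (1 − λ_i/λ_{i′})(1 − κ_j/κ_{j′})` of two
diagonal-conjugation masks, which vanish exactly on the invisible cells `{i = i′} ∪ {j = j′}`.
Use on this line: (i) a REFUTATION CRITERION for `stub_coreLinear` that needs no search over completions
(`not_exists_completion_of_mask`, `coreLinear_witness_bound`): an admissible core `D` and a mask `σ` with
`rank (D ⊙ σ) > C·c·rank σ` refute the constant `C`; (ii) a certified lower bound for numerics at sizes where exact `mc` is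
out of reach.  Weak duality only: the bound is not claimed to be tight.
HONEST FRAMING: a tool (three short theorems); CORE-LINEAR, the crux and P ≠ NP are not touched; F-N2 is a FRONTIER
formal rung.
-/

set_option linter.dupNamespace false -- `Summit.PneNP.PneNP.…`: summit = sub-problem name (D-0017)

namespace Summit.PneNP.PneNP.Theorems.CnfIdealGenLengthRankDefectRepresentationsMaskBound

open Matrix
open Literature.LinearAlgebra.Matrix.HadamardProductRank (rank_hadamard_le)
open Summit.PneNP.PneNP.Theorems.CnfIdealGenLengthRankDefectRepresentationsTwoFamilyCutDomination (colourI colourJ)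

variable {K : Type} [Field K] {ι ι' : Type} [Fintype ι] [Fintype ι']

/-- **MASK BOUND** (general pattern).  If `σ` vanishes off the visible cells `vis` and `L` agrees with `D` on them, then
`rank (D ⊙ σ) ≤ rank L · rank σ`. -/
theorem rank_hadamard_mask_le (vis : ι → ι' → Prop) (D L σ : Matrix ι ι' K)
    (hσ : ∀ x y, ¬ vis x y → σ x y = 0) (hL : ∀ x y, vis x y → L x y = D x y) :
    (D ⊙ σ).rank ≤ L.rank * σ.rank := by
  have h : D ⊙ σ = L ⊙ σ := by
    ext x y
    simp only [hadamard_apply]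
    by_cases hv : vis x y
    · rw [hL x y hv]
    · rw [hσ x y hv, mul_zero, mul_zero]
  rw [h]
  exact rank_hadamard_le L σ

/-- **Refutation criterion.**  A mask `σ` (vanishing off the visible cells) with `rank (D ⊙ σ) > Λ · rank σ` shows that NO
matrix of rank `≤ Λ` agrees with `D` on the visible cells. -/
theorem not_exists_completion_of_mask (vis : ι → ι' → Prop) (D σ : Matrix ι ι' K) (Λ : ℕ)
    (hσ : ∀ x y, ¬ vis x y → σ x y = 0) (hbig : Λ * σ.rank < (D ⊙ σ).rank) :
    ¬ ∃ L : Matrix ι ι' K, L.rank ≤ Λ ∧ ∀ x y, vis x y → L x y = D x y := by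
  rintro ⟨L, hr, hL⟩
  have h := rank_hadamard_mask_le vis D L σ hσ hL
  exact absurd (h.trans (Nat.mul_le_mul_right _ hr)) (not_le.2 hbig)

/-- **The criterion in the vocabulary of `stub_coreLinear`** (two-family colourings `row`, `col`; core grid `P₀ × Q₀`):
every matrix `L` agreeing with `D` at the visible core cells — exactly the conclusion of the registered stub — satisfies
`rank (D ⊙ σ) ≤ rank L · rank σ` for every mask `σ` supported on those cells.  Hence an instance with all double cuts `≤ c`,
`#P₀, #Q₀ ≤ c` and a mask with `rank (D ⊙ σ) > C·c·rank σ` refutes the constant `C` in CORE-LINEAR. -/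
theorem coreLinear_witness_bound {n n' : ℕ} (row : ι → Fin n ⊕ Fin n' → Bool) (col : ι' → Fin n ⊕ Fin n' → Bool)
    (D L σ : Matrix ι ι' K) (P₀ : Finset (Fin n → Bool)) (Q₀ : Finset (Fin n' → Bool))
    (hσ : ∀ x y, ¬ (colourI (row x) ≠ colourI (col y) ∧ colourJ (row x) ≠ colourJ (col y) ∧
        colourI (row x) ∈ P₀ ∧ colourJ (row x) ∈ Q₀ ∧ colourI (col y) ∈ P₀ ∧ colourJ (col y) ∈ Q₀) → σ x y = 0)
    (hL : ∀ x y, colourI (row x) ≠ colourI (col y) → colourJ (row x) ≠ colourJ (col y) →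
        colourI (row x) ∈ P₀ → colourJ (row x) ∈ Q₀ → colourI (col y) ∈ P₀ → colourJ (col y) ∈ Q₀ → L x y = D x y) :
    (D ⊙ σ).rank ≤ L.rank * σ.rank :=
  rank_hadamard_mask_le
    (fun x y => colourI (row x) ≠ colourI (col y) ∧ colourJ (row x) ≠ colourJ (col y) ∧
      colourI (row x) ∈ P₀ ∧ colourJ (row x) ∈ Q₀ ∧ colourI (col y) ∈ P₀ ∧ colourJ (col y) ∈ Q₀)
    D L σ hσ (fun x y h => hL x y h.1 h.2.1 h.2.2.1 h.2.2.2.1 h.2.2.2.2.1 h.2.2.2.2.2)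

end Summit.PneNP.PneNP.Theorems.CnfIdealGenLengthRankDefectRepresentationsMaskBound
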